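import Summits.Ventures.PercRepro.C041FoldMaps

/-!
# ROW C-041 — THE CANONICAL TREE ZONE EMBEDS INTO ITS MODEL: `t.toZone ∈ IsZe`, THE CONE FORM OF THEOREM (trees)
(p6, gen 30)

Mine-3's canonical zone `t.toZone` of a rooted marked tree (`C041TreeBridgeDefs`) embeds (`C041ZoneEmb`) into the
tree model `(treeModel t).Z` of `C041GlueFold` — the root's marked point glued at the root with the edge-pendants of
the children's models — with the tools of `C041FoldMaps`: the root goes to the fold's anchor, a position inside
child `j` to the `j`-th summand through the child's map and the pendant's redirection (`treeV`; the child's root to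
the far end `true` of the edge, `treeV_root`), the edges and marks by the recursive equivalences (`treeE`, `treeM1`,
`treeM2`), the end maps commute (`fst_treeE`, `snd_treeE`, `at₁_treeM1`, `at₂_treeM2`, with the computation rules
`toZone_fst_none`, … of `TZ.toZone`), and the vertex map is injective (`treeV_injective`: the summands' anchors
are never hit — `red true` sends the child's root to `inl true`, never to the near end `inl false`;
`foldInjV_eq`, `foldInjV_ne_foldAccV`).  Hence `treeEmb t : ZoneEmb t.toZone (treeModel t).Z`, and by `embDown`
**`isZe_toZone : IsZe t.toZone t.root`**, so **`inCone_sixVec_toZone : InCone (t.toZone.sixVec t.root)`** —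
THEOREM (trees) in CONE form (the count form is `TZ.zoneOCubeConj_toZone` of `C041TreeZoneBridge`; re-derived here
as `zoneOCubeConj_toZone'`, with `zoneCSConj_toZone'`).
-/

namespace PercRepro

namespace ZoneZ

namespace AZone

open ZoneData TreeClosure Pendant AnchorGlue PointZone

/-! ## The canonical tree zone: its vertex map, edges and marks into the model -/

/-- The summands of the tree model: the edge-pendants of the children's models. -/
noncomputable abbrev childPkg (d : ℕ) (cs : Fin d → TZ) : Fin d → AZone := fun j => edgePendant (treeModel (cs j))

/-- The tree model of a node is the fold of its children's edge-pendants onto the root's point. -/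
theorem treeModel_node (p q d : ℕ) (cs : Fin d → TZ) :
    treeModel (.node p q d cs) = foldGlue d (childPkg d cs) (point p q) := rfl

/-- THE VERTEX MAP: the root to the fold's anchor; a position inside child `j` to the `j`-th summand through the
child's map and the pendant's redirection (the child's root to the far end `true` of the edge). -/
noncomputable def treeV : (t : TZ) → t.Pos → (treeModel t).V
  | .node p q d cs, none => foldAccV d (childPkg d cs) (point p q) ()
  | .node p q d cs, some ⟨j, x⟩ =>
    foldInjV d (childPkg d cs) (point p q) j (red true (treeModel (cs j)).k (treeV (cs j) x))

/-- The root goes to the model's anchor. -/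
theorem treeV_root : ∀ t : TZ, treeV t t.root = (treeModel t).k
  | .node p q d cs => (foldGlue_k d (childPkg d cs) (point p q)).symm

/-- THE EDGES: the root edge of child `j` is the `K₂` edge of summand `j`, an edge inside child `j` its image. -/
noncomputable def treeE : (t : TZ) → t.Edge ≃ (treeModel t).E
  | .node p q d cs =>
    (Equiv.sigmaCongrRight fun j => (Equiv.optionEquivSumPUnit (cs j).Edge).trans
        ((Equiv.sumComm _ _).trans ((Equiv.refl Unit).sumCongr (treeE (cs j))))).trans
      ((Equiv.sumEmpty _ Empty).symm.trans (foldEquivE d (childPkg d cs) (point p q)))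

/-- THE `1`-MARKS: the root's own to the point's, a mark inside child `j` to summand `j`. -/
noncomputable def treeM1 : (t : TZ) → t.M1 ≃ (treeModel t).T₁
  | .node p q d cs =>
    (Equiv.sumComm (Fin p) _).trans
      (((Equiv.sigmaCongrRight fun j => treeM1 (cs j)).sumCongr (Equiv.refl (Fin p))).trans
        (foldEquivT₁ d (childPkg d cs) (point p q)))

/-- THE `2`-MARKS. -/
noncomputable def treeM2 : (t : TZ) → t.M2 ≃ (treeModel t).T₂
  | .node p q d cs =>
    (Equiv.sumComm (Fin q) _).trans
      (((Equiv.sigmaCongrRight fun j => treeM2 (cs j)).sumCongr (Equiv.refl (Fin q))).trans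
        (foldEquivT₂ d (childPkg d cs) (point p q)))

/-- The root edge of child `j`. -/
theorem treeE_none (p q d : ℕ) (cs : Fin d → TZ) (j : Fin d) :
    treeE (.node p q d cs) ⟨j, none⟩ = foldEquivE d (childPkg d cs) (point p q) (Sum.inl ⟨j, Sum.inl ()⟩) := rfl

/-- An edge inside child `j`. -/
theorem treeE_some (p q d : ℕ) (cs : Fin d → TZ) (j : Fin d) (e : (cs j).Edge) :
    treeE (.node p q d cs) ⟨j, some e⟩ =
      foldEquivE d (childPkg d cs) (point p q) (Sum.inl ⟨j, Sum.inr (treeE (cs j) e)⟩) := rfl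

/-- A root `1`-mark. -/
theorem treeM1_inl (p q d : ℕ) (cs : Fin d → TZ) (i : Fin p) :
    treeM1 (.node p q d cs) (Sum.inl i) = foldEquivT₁ d (childPkg d cs) (point p q) (Sum.inr i) := rfl

/-- A `1`-mark inside child `j`. -/
theorem treeM1_inr (p q d : ℕ) (cs : Fin d → TZ) (j : Fin d) (m : (cs j).M1) :
    treeM1 (.node p q d cs) (Sum.inr ⟨j, m⟩) =
      foldEquivT₁ d (childPkg d cs) (point p q) (Sum.inl ⟨j, treeM1 (cs j) m⟩) := rfl

/-- A root `2`-mark. -/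
theorem treeM2_inl (p q d : ℕ) (cs : Fin d → TZ) (i : Fin q) :
    treeM2 (.node p q d cs) (Sum.inl i) = foldEquivT₂ d (childPkg d cs) (point p q) (Sum.inr i) := rfl

/-- A `2`-mark inside child `j`. -/
theorem treeM2_inr (p q d : ℕ) (cs : Fin d → TZ) (j : Fin d) (m : (cs j).M2) :
    treeM2 (.node p q d cs) (Sum.inr ⟨j, m⟩) =
      foldEquivT₂ d (childPkg d cs) (point p q) (Sum.inl ⟨j, treeM2 (cs j) m⟩) := rfl

/-! ## The end maps of the canonical tree zone -/

/-- The root edge of child `j` starts at the root. -/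
theorem toZone_fst_none (p q d : ℕ) (cs : Fin d → TZ) (j : Fin d) :
    (TZ.node p q d cs).toZone.fst ⟨j, none⟩ = none := by
  rw [TZ.toZone]

/-- An edge inside child `j` starts inside child `j`. -/
theorem toZone_fst_some (p q d : ℕ) (cs : Fin d → TZ) (j : Fin d) (e : (cs j).Edge) :
    (TZ.node p q d cs).toZone.fst ⟨j, some e⟩ = some ⟨j, (cs j).toZone.fst e⟩ := by
  rw [TZ.toZone]

/-- The root edge of child `j` ends at the child's root. -/
theorem toZone_snd_none (p q d : ℕ) (cs : Fin d → TZ) (j : Fin d) :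
    (TZ.node p q d cs).toZone.snd ⟨j, none⟩ = some ⟨j, (cs j).root⟩ := by
  rw [TZ.toZone]

/-- An edge inside child `j` ends inside child `j`. -/
theorem toZone_snd_some (p q d : ℕ) (cs : Fin d → TZ) (j : Fin d) (e : (cs j).Edge) :
    (TZ.node p q d cs).toZone.snd ⟨j, some e⟩ = some ⟨j, (cs j).toZone.snd e⟩ := by
  rw [TZ.toZone]

/-- A root `1`-mark sits at the root. -/
theorem toZone_at₁_inl (p q d : ℕ) (cs : Fin d → TZ) (i : Fin p) :
    (TZ.node p q d cs).toZone.at₁ (Sum.inl i) = none := by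
  rw [TZ.toZone]

/-- A `1`-mark inside child `j` sits inside child `j`. -/
theorem toZone_at₁_inr (p q d : ℕ) (cs : Fin d → TZ) (j : Fin d) (m : (cs j).M1) :
    (TZ.node p q d cs).toZone.at₁ (Sum.inr ⟨j, m⟩) = some ⟨j, (cs j).toZone.at₁ m⟩ := by
  rw [TZ.toZone]

/-- A root `2`-mark sits at the root. -/
theorem toZone_at₂_inl (p q d : ℕ) (cs : Fin d → TZ) (i : Fin q) :
    (TZ.node p q d cs).toZone.at₂ (Sum.inl i) = none := by
  rw [TZ.toZone]

/-- A `2`-mark inside child `j` sits inside child `j`. -/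
theorem toZone_at₂_inr (p q d : ℕ) (cs : Fin d → TZ) (j : Fin d) (m : (cs j).M2) :
    (TZ.node p q d cs).toZone.at₂ (Sum.inr ⟨j, m⟩) = some ⟨j, (cs j).toZone.at₂ m⟩ := by
  rw [TZ.toZone]

/-- The first ends correspond. -/
theorem fst_treeE : ∀ (t : TZ) (e : t.Edge), (treeModel t).Z.fst (treeE t e) = treeV t (t.toZone.fst e)
  | .node p q d cs, ⟨j, none⟩ => by
    rw [toZone_fst_none]
    exact (fst_foldEquivE_inl d (childPkg d cs) (point p q) j (Sum.inl ())).trans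
      (foldInjV_k d (childPkg d cs) (point p q) j)
  | .node p q d cs, ⟨j, some e⟩ => by
    rw [toZone_fst_some]
    show _ = foldInjV d (childPkg d cs) (point p q) j
      (red true (treeModel (cs j)).k (treeV (cs j) ((cs j).toZone.fst e)))
    rw [← fst_treeE (cs j) e]
    exact fst_foldEquivE_inl d (childPkg d cs) (point p q) j (Sum.inr (treeE (cs j) e))

/-- The second ends correspond. -/
theorem snd_treeE : ∀ (t : TZ) (e : t.Edge), (treeModel t).Z.snd (treeE t e) = treeV t (t.toZone.snd e)
  | .node p q d cs, ⟨j, none⟩ => by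
    rw [toZone_snd_none]
    show _ = foldInjV d (childPkg d cs) (point p q) j
      (red true (treeModel (cs j)).k (treeV (cs j) (cs j).root))
    rw [treeV_root, red_self]
    exact snd_foldEquivE_inl d (childPkg d cs) (point p q) j (Sum.inl ())
  | .node p q d cs, ⟨j, some e⟩ => by
    rw [toZone_snd_some]
    show _ = foldInjV d (childPkg d cs) (point p q) j
      (red true (treeModel (cs j)).k (treeV (cs j) ((cs j).toZone.snd e)))
    rw [← snd_treeE (cs j) e]
    exact snd_foldEquivE_inl d (childPkg d cs) (point p q) j (Sum.inr (treeE (cs j) e))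

/-- The vertices of the `1`-marks correspond. -/
theorem at₁_treeM1 : ∀ (t : TZ) (m : t.M1), (treeModel t).Z.at₁ (treeM1 t m) = treeV t (t.toZone.at₁ m)
  | .node p q d cs, Sum.inl i => by
    rw [toZone_at₁_inl]
    exact at₁_foldEquivT₁_inr d (childPkg d cs) (point p q) i
  | .node p q d cs, Sum.inr ⟨j, m⟩ => by
    rw [toZone_at₁_inr]
    show _ = foldInjV d (childPkg d cs) (point p q) j
      (red true (treeModel (cs j)).k (treeV (cs j) ((cs j).toZone.at₁ m)))
    rw [← at₁_treeM1 (cs j) m]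
    exact at₁_foldEquivT₁_inl d (childPkg d cs) (point p q) j (treeM1 (cs j) m)

/-- The vertices of the `2`-marks correspond. -/
theorem at₂_treeM2 : ∀ (t : TZ) (m : t.M2), (treeModel t).Z.at₂ (treeM2 t m) = treeV t (t.toZone.at₂ m)
  | .node p q d cs, Sum.inl i => by
    rw [toZone_at₂_inl]
    exact at₂_foldEquivT₂_inr d (childPkg d cs) (point p q) i
  | .node p q d cs, Sum.inr ⟨j, m⟩ => by
    rw [toZone_at₂_inr]
    show _ = foldInjV d (childPkg d cs) (point p q) j
      (red true (treeModel (cs j)).k (treeV (cs j) ((cs j).toZone.at₂ m)))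
    rw [← at₂_treeM2 (cs j) m]
    exact at₂_foldEquivT₂_inl d (childPkg d cs) (point p q) j (treeM2 (cs j) m)

/-! ## Injectivity of the vertex map -/

/-- The redirection is injective. -/
theorem red_injective {V₁ V₂ : Type*} (u : V₁) (a₂ : V₂) {x x' : V₂} (h : red u a₂ x = red u a₂ x') : x = x' := by
  by_cases hx : x = a₂
  · by_cases hx' : x' = a₂
    · rw [hx, hx']
    · rw [hx, red_self, red_of_ne u hx'] at h
      exact absurd h (by simp)
  · by_cases hx' : x' = a₂
    · rw [hx', red_self, red_of_ne u hx] at h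
      exact absurd h (by simp)
    · rw [red_of_ne u hx, red_of_ne u hx'] at h
      exact Sum.inr.inj h

/-- The redirection to the far end `true` never hits the near end `false`. -/
theorem red_true_ne_inl_false {V₂ : Type*} (a₂ x : V₂) : red true a₂ x ≠ (Sum.inl false : Bool ⊕ V₂) := by
  by_cases hx : x = a₂
  · rw [hx, red_self]
    simp
  · rw [red_of_ne true hx]
    simp

/-- Two non-anchor vertices of summands with the same image are the same vertex of the same summand. -/
theorem foldInjV_eq : ∀ (d : ℕ) (f : Fin d → AZone) (acc : AZone) (j j' : Fin d) (y : (f j).V) (y' : (f j').V),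
    y ≠ (f j).k → y' ≠ (f j').k → foldInjV d f acc j y = foldInjV d f acc j' y' →
      (⟨j, y⟩ : Σ j, (f j).V) = ⟨j', y'⟩
  | 0, _, _, j, _, _, _, _, _, _ => j.elim0
  | d + 1, f, acc, j, j', y, y', hy, hy', h => by
    induction j using Fin.lastCases with
    | last =>
      induction j' using Fin.lastCases with
      | last =>
        rw [foldInjV_last, foldInjV_last, red_of_ne _ hy, red_of_ne _ hy'] at h
        rw [Sum.inr.inj h]
      | cast j' =>
        rw [foldInjV_last, foldInjV_castSucc, red_of_ne _ hy] at h
        exact absurd h (by simp)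
    | cast j =>
      induction j' using Fin.lastCases with
      | last =>
        rw [foldInjV_castSucc, foldInjV_last, red_of_ne _ hy'] at h
        exact absurd h (by simp)
      | cast j' =>
        rw [foldInjV_castSucc, foldInjV_castSucc] at h
        have h1 := foldInjV_eq d (fun j => f j.castSucc) acc j j' y y' hy hy' (Sum.inl.inj h)
        obtain ⟨rfl, h2⟩ := Sigma.mk.inj_iff.1 h1
        rw [eq_of_heq h2]

/-- A non-anchor vertex of a summand is never an accumulator vertex. -/
theorem foldInjV_ne_foldAccV : ∀ (d : ℕ) (f : Fin d → AZone) (acc : AZone) (j : Fin d) (y : (f j).V),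
    y ≠ (f j).k → ∀ a : acc.V, foldInjV d f acc j y ≠ foldAccV d f acc a
  | 0, _, _, j, _, _, _ => j.elim0
  | d + 1, f, acc, j, y, hy, a => by
    induction j using Fin.lastCases with
    | last =>
      rw [foldInjV_last, red_of_ne _ hy]
      simp [foldAccV]
    | cast j =>
      rw [foldInjV_castSucc]
      intro h
      exact foldInjV_ne_foldAccV d (fun j => f j.castSucc) acc j y hy a (Sum.inl.inj h)

/-- THE VERTEX MAP IS INJECTIVE: the summands' anchors are never hit. -/
theorem treeV_injective : ∀ t : TZ, Function.Injective (treeV t)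
  | .node p q d cs => by
    rintro (_ | ⟨j, x⟩) (_ | ⟨j', x'⟩) h
    · rfl
    · exact absurd h.symm
        (foldInjV_ne_foldAccV d (childPkg d cs) (point p q) j' _ (red_true_ne_inl_false _ _) ())
    · exact absurd h (foldInjV_ne_foldAccV d (childPkg d cs) (point p q) j _ (red_true_ne_inl_false _ _) ())
    · have h1 := foldInjV_eq d (childPkg d cs) (point p q) j j' _ _ (red_true_ne_inl_false _ _)
        (red_true_ne_inl_false _ _) h
      obtain ⟨rfl, h2⟩ := Sigma.mk.inj_iff.1 h1
      rw [treeV_injective (cs j) (red_injective _ _ (eq_of_heq h2))]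

/-! ## The embedding and the theorem -/

/-- **THE EMBEDDING of the canonical tree zone into its model.** -/
noncomputable def treeEmb (t : TZ) : ZoneEmb t.toZone (treeModel t).Z where
  v := treeV t
  inj := treeV_injective t
  e := treeE t
  t₁ := treeM1 t
  t₂ := treeM2 t
  fst_map := fst_treeE t
  snd_map := snd_treeE t
  at₁_map := at₁_treeM1 t
  at₂_map := at₂_treeM2 t

/-- The embedding sends the root to the model's anchor. -/
theorem treeEmb_v_root (t : TZ) : (treeEmb t).v t.root = (treeModel t).k := treeV_root t

/-- **THE CANONICAL ZONE OF EVERY ROOTED MARKED TREE IS A MEMBER OF THE CLASS.** -/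
theorem isZe_toZone (t : TZ) : ZoneZ.IsZe t.toZone t.root :=
  ZoneZ.IsZe.embDown t.root (treeEmb t) (by rw [treeEmb_v_root]; exact isZe_treeModel t)

/-- **THEOREM (trees) IN CONE FORM**: the six-vector of the canonical zone of every rooted marked tree lies in the
cone. -/
theorem inCone_sixVec_toZone (t : TZ) : InCone (t.toZone.sixVec t.root) :=
  (isZe_toZone t).inCone _ _ _ _ _ _

/-- The one-anchor (CS) on every tree zone, from the cone. -/
theorem zoneCSConj_toZone' (t : TZ) : t.toZone.ZoneCSConj {t.root} (∅ : Set t.Pos) :=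
  (isZe_toZone t).zoneCSConj

/-- The ZONE O-CUBE on every tree zone, from the cone (the count form is `TZ.zoneOCubeConj_toZone`). -/
theorem zoneOCubeConj_toZone' (t : TZ) : t.toZone.ZoneOCubeConj {t.root} (∅ : Set t.Pos) :=
  (isZe_toZone t).zoneOCubeConj

/-- Every zone isomorphic to the canonical zone of a rooted marked tree is a member of the class. -/
theorem isZe_of_iso_toZone (t : TZ) {V' E' T₁' T₂' : Type} {Z' : ZoneData V' E' T₁' T₂'}
    (φ : ZoneIso t.toZone Z') : ZoneZ.IsZe Z' (φ.v t.root) :=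
  ZoneZ.IsZe.iso t.root φ (isZe_toZone t)

/-- The six-vector of every zone isomorphic to a tree zone lies in the cone. -/
theorem inCone_sixVec_of_iso_toZone (t : TZ) {V' E' T₁' T₂' : Type} {Z' : ZoneData V' E' T₁' T₂'}
    [Fintype E'] [DecidableEq E'] [Fintype T₁'] [DecidableEq T₁'] [Fintype T₂'] [DecidableEq T₂']
    (φ : ZoneIso t.toZone Z') : InCone (Z'.sixVec (φ.v t.root)) :=
  (isZe_of_iso_toZone t φ).inCone _ _ _ _ _ _

end AZone

end ZoneZ

end PercRepro
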